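import Summits.ValiantsHypothesis.ValiantsHypothesis.Theorems.LacunarySymmetroidMatrixDescartesFiniteSectorEtaKThree

/-!
# `MatrixDescartes` — line «finite»: the SECTOR ceilings of the `K = 3` column BY NAME for `m = 6, 7`:
# `η(6,3) ≤ 36 = σ(6,3)`, `η(7,3) ≤ 46 = σ(7,3)` (`HypRootLawAt 6 3 36`, `HypRootLawAt 7 3 46`)

HONEST FRAMING.  Object-search cell `pub-symmetroid`, seat val-sym-eng-3 g4.  HELPER of the crux item `stmt-ValiantsHypothesis-18050`
(`Theses.LacunarySymmetroid.MatrixDescartes`, asymptotic in `K`) with NO closure claim.  Continuation of `…FiniteSectorEtaKThree`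
(`η(4,3) = 20`, `η(5,3) = 28`) two sizes up, UPPER SIDES ONLY: the PROVED gap-rule SIEVE (`…FiniteSector.sieve`, `natDegree_mem_sumset`)
made uniform in the support — the `m`-fold sums of three exponents with a forced `0` are `{q·x + s·y : q + s ≤ m}`, and a step-`≤ 2` chain
from `{0,1}` to `n` inside them forces `n ≤ σ(m,3)` with `σ(6,3) = 36`, `σ(7,3) = 46` (`= 2·n(m,2)`, Stöhr; the seat's enumeration finds the
chain top only at `{0,2,8}` resp. `{0,2,10}`), by the generated leaf-by-leaf case analysis of `…EtaKThree` (`interval_cases` + `omega`, no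
`decide`).  The matching LOWER sides `η(6,3) ≥ 36`, `η(7,3) ≥ 46` would need full-positive-rooted realisations `ν(6,3) = 18`, `ν(7,3) = 23`,
which are OPEN (kit-class searches; `…StampCeilingKThree` has the stamp-side ceilings `ν ≤ 18, 23`).  Nothing here bears on the crux or on
`VP ≠ VNP`.  [folklore] Elementary additive bookkeeping; no citation is load-bearing.
-/

-- `Summit.ValiantsHypothesis.ValiantsHypothesis.…` repeats a component by the D-0017 layout
-- (single-conjunct summit), which the `dupNamespace` linter flags; the name is mandated.
set_option linter.dupNamespace false

namespace Summit.ValiantsHypothesis.ValiantsHypothesis.Theorems.LacunarySymmetroidMatrixDescartes.FiniteSector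

open scoped BigOperators Matrix
open Polynomial

/-! ## m = 6: a step-`≤ 2` chain in `{q·x + s·y : q + s ≤ 6}` stops by `36` -/

set_option maxHeartbeats 4000000 in
/-- Core case `1 ≤ x ≤ 2`, `1 ≤ y`: explicit double gaps (generated leaf by leaf). [folklore] -/
theorem chain63_core (x y n : ℕ) (hx1 : 1 ≤ x) (hx : x ≤ 2) (hy1 : 1 ≤ y) (hn : 37 ≤ n)
    (hmem : (∃ q s : ℕ, q + s ≤ 6 ∧ q * x + s * y = n))
    (hchain : (∀ r, r + 2 ≤ n → (∃ q s : ℕ, q + s ≤ 6 ∧ q * x + s * y = r) ∨ (∃ q s : ℕ, q + s ≤ 6 ∧ q * x + s * y = (r + 1)))) : False := by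
  obtain ⟨q0, s0, hqs0, hn0⟩ := hmem
  interval_cases x
  · -- x = 1: the chain at r = 7 forces y ≤ 8
    have hy : y ≤ 8 := by
      have h := ybound (m := 6) (n := n) (hG := by omega) (hgap := fun q hq => ⟨by omega, by omega⟩) (hc := hchain 7 (by omega))
      omega
    interval_cases y
    · omega -- y = 1: every sum ≤ 6 < 37
    · omega -- y = 2: every sum ≤ 12 < 37
    · omega -- y = 3: every sum ≤ 18 < 37
    · omega -- y = 4: every sum ≤ 24 < 37
    · omega -- y = 5: every sum ≤ 30 < 37
    · omega -- y = 6: every sum ≤ 36 < 37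
    · -- y = 7: sums ≥ 37 start [42]; double gap at 19, 20
      rcases hchain 19 (by omega) with ⟨q, s, hqs, h⟩ | ⟨q, s, hqs, h⟩
      · have hs' : s ≤ 6 := by omega
        interval_cases s <;> omega
      · have hs' : s ≤ 6 := by omega
        interval_cases s <;> omega
    · -- y = 8: sums ≥ 37 start [40, 41, 48]; double gap at 14, 15
      rcases hchain 14 (by omega) with ⟨q, s, hqs, h⟩ | ⟨q, s, hqs, h⟩
      · have hs' : s ≤ 6 := by omega
        interval_cases s <;> omega
      · have hs' : s ≤ 6 := by omega
        interval_cases s <;> omega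
  · -- x = 2: the chain at r = 13 forces y ≤ 14
    have hy : y ≤ 14 := by
      have h := ybound (m := 6) (n := n) (hG := by omega) (hgap := fun q hq => ⟨by omega, by omega⟩) (hc := hchain 13 (by omega))
      omega
    interval_cases y
    · omega -- y = 1: every sum ≤ 12 < 37
    · omega -- y = 2: every sum ≤ 12 < 37
    · omega -- y = 3: every sum ≤ 18 < 37
    · omega -- y = 4: every sum ≤ 24 < 37
    · omega -- y = 5: every sum ≤ 30 < 37
    · omega -- y = 6: every sum ≤ 36 < 37
    · -- y = 7: sums ≥ 37 start [37, 42]; double gap at 33, 34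
      rcases hchain 33 (by omega) with ⟨q, s, hqs, h⟩ | ⟨q, s, hqs, h⟩
      · have hs' : s ≤ 6 := by omega
        interval_cases s <;> omega
      · have hs' : s ≤ 6 := by omega
        interval_cases s <;> omega
    · -- y = 8: sums ≥ 37 start [40, 42, 48]; double gap at 37, 38
      rcases hchain 37 (by omega) with ⟨q, s, hqs, h⟩ | ⟨q, s, hqs, h⟩
      · have hs' : s ≤ 6 := by omega
        interval_cases s <;> omega
      · have hs' : s ≤ 6 := by omega
        interval_cases s <;> omega
    · -- y = 9: sums ≥ 37 start [38, 40, 45]; double gap at 34, 35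
      rcases hchain 34 (by omega) with ⟨q, s, hqs, h⟩ | ⟨q, s, hqs, h⟩
      · have hs' : s ≤ 6 := by omega
        interval_cases s <;> omega
      · have hs' : s ≤ 6 := by omega
        interval_cases s <;> omega
    · -- y = 10: sums ≥ 37 start [40, 42, 44]; double gap at 37, 38
      rcases hchain 37 (by omega) with ⟨q, s, hqs, h⟩ | ⟨q, s, hqs, h⟩
      · have hs' : s ≤ 6 := by omega
        interval_cases s <;> omega
      · have hs' : s ≤ 6 := by omega
        interval_cases s <;> omega
    · -- y = 11: sums ≥ 37 start [37, 39, 44]; double gap at 31, 32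
      rcases hchain 31 (by omega) with ⟨q, s, hqs, h⟩ | ⟨q, s, hqs, h⟩
      · have hs' : s ≤ 6 := by omega
        interval_cases s <;> omega
      · have hs' : s ≤ 6 := by omega
        interval_cases s <;> omega
    · -- y = 12: sums ≥ 37 start [38, 40, 42]; double gap at 33, 34
      rcases hchain 33 (by omega) with ⟨q, s, hqs, h⟩ | ⟨q, s, hqs, h⟩
      · have hs' : s ≤ 6 := by omega
        interval_cases s <;> omega
      · have hs' : s ≤ 6 := by omega
        interval_cases s <;> omega
    · -- y = 13: sums ≥ 37 start [39, 41, 43]; double gap at 24, 25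
      rcases hchain 24 (by omega) with ⟨q, s, hqs, h⟩ | ⟨q, s, hqs, h⟩
      · have hs' : s ≤ 6 := by omega
        interval_cases s <;> omega
      · have hs' : s ≤ 6 := by omega
        interval_cases s <;> omega
    · -- y = 14: sums ≥ 37 start [42, 44, 46]; double gap at 25, 26
      rcases hchain 25 (by omega) with ⟨q, s, hqs, h⟩ | ⟨q, s, hqs, h⟩
      · have hs' : s ≤ 6 := by omega
        interval_cases s <;> omega
      · have hs' : s ≤ 6 := by omega
        interval_cases s <;> omega

/-- **The `(6,3)` sieve bound.** [folklore] -/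
theorem chain63 (x y n : ℕ) (hn : 37 ≤ n) (hmem : (∃ q s : ℕ, q + s ≤ 6 ∧ q * x + s * y = n))
    (hchain : (∀ r, r + 2 ≤ n → (∃ q s : ℕ, q + s ≤ 6 ∧ q * x + s * y = r) ∨ (∃ q s : ℕ, q + s ≤ 6 ∧ q * x + s * y = (r + 1)))) : False := by
  have one_denom : ∀ a b : ℕ, a = 0 → (∃ q s : ℕ, q + s ≤ 6 ∧ q * a + s * b = n) → (∀ r, r + 2 ≤ n → (∃ q s : ℕ, q + s ≤ 6 ∧ q * a + s * b = r) ∨ (∃ q s : ℕ, q + s ≤ 6 ∧ q * a + s * b = (r + 1))) → False := by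
    intro a b ha hm hch
    subst ha
    obtain ⟨q1, s1, hqs1, hn1⟩ := hm
    have hb : b ≤ 2 := by
      rcases hch 1 (by omega) with ⟨q, s, hqs, h⟩ | ⟨q, s, hqs, h⟩
      · rcases Nat.eq_zero_or_pos s with hs | hs
        · subst hs; omega
        · have := self_le_mul_of_one_le (b := b) hs; omega
      · rcases Nat.eq_zero_or_pos s with hs | hs
        · subst hs; omega
        · have := self_le_mul_of_one_le (b := b) hs; omega
    interval_cases b <;> omega
  rcases Nat.eq_zero_or_pos x with hx0 | hx1
  · exact one_denom x y hx0 hmem hchain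
  rcases Nat.eq_zero_or_pos y with hy0 | hy1
  · exact one_denom y x hy0 (inS_comm' hmem) (fun r hr => (hchain r hr).imp inS_comm' inS_comm')
  rcases Nat.lt_or_ge x 3 with hx3 | hx3
  · exact chain63_core x y n hx1 (by omega) hy1 hn hmem hchain
  rcases Nat.lt_or_ge y 3 with hy3 | hy3
  · exact chain63_core y x n hy1 (by omega) hx1 hn (inS_comm' hmem) (fun r hr => (hchain r hr).imp inS_comm' inS_comm')
  have key : ∀ r, (∃ q s : ℕ, q + s ≤ 6 ∧ q * x + s * y = r) → r = 0 ∨ 3 ≤ r := by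
    rintro r ⟨q, s, hqs, h⟩
    rcases Nat.eq_zero_or_pos q with hq | hq
    · rcases Nat.eq_zero_or_pos s with hs | hs
      · subst hq; subst hs; left; omega
      · have := self_le_mul_of_one_le (b := y) hs; right; omega
    · have := self_le_mul_of_one_le (b := x) hq; right; omega
  rcases hchain 1 (by omega) with h | h
  · rcases key 1 h with h' | h' <;> omega
  · rcases key 2 h with h' | h' <;> omega

/-- **`η(6,3) ≤ 36 = σ(6,3)`** (`HypRootLawAt 6 3 36`): every real symmetric `6 × 6` lacunary pencil with `3` terms whose
determinant lies in the sector has determinant degree `≤ 36` — ALL supports `d : Fin 3 → ℕ`.  (Realisation of the matching lower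
side, `ν(6,3) = 18`, is OPEN — kit-class search.) [folklore] -/
theorem hypRootLawAt_six_three_36 : HypRootLawAt 6 3 36 := by
  intro d S hS hsec
  by_contra hdeg'
  have hdeg : 36 < (pencil d S).det.natDegree := not_le.mp hdeg'
  have hq : (pencil d S).det ≠ 0 := by
    intro h0
    rw [h0] at hdeg
    simp at hdeg
  have himage : ∀ r, r ∈ (Finset.univ : Finset (Sym (Fin 3) 6)).image
      (fun s : Sym (Fin 3) 6 => ((s : Multiset (Fin 3)).map d).sum) →
      ∃ s : Multiset (Fin 3), Multiset.card s = 6 ∧ (s.map d).sum = r := by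
    intro r hr
    rw [Finset.mem_image] at hr
    obtain ⟨s, -, hs⟩ := hr
    exact ⟨(s : Multiset (Fin 3)), s.2, hs⟩
  have hsieve : ∀ r, r + 2 ≤ (pencil d S).det.natDegree →
      (∃ s : Multiset (Fin 3), Multiset.card s = 6 ∧ (s.map d).sum = r) ∨
      (∃ s : Multiset (Fin 3), Multiset.card s = 6 ∧ (s.map d).sum = r + 1) := by
    intro r hr
    rcases sieve d S hq hsec hr with h | h
    · exact Or.inl (himage r h)
    · exact Or.inr (himage (r + 1) h)
  have htop := himage _ (natDegree_mem_sumset d S hq)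
  obtain ⟨a, ha⟩ : ∃ a, d a = 0 := by
    rcases hsieve 0 (by omega) with ⟨s, hsc, hs⟩ | ⟨s, hsc, hs⟩
    · exact exists_eq_zero_of_sum_le_one d s (by omega) (by omega)
    · exact exists_eq_zero_of_sum_le_one d s (by omega) (by omega)
  obtain ⟨x, y, hxy⟩ := values_fin_three_zero d a ha
  have hIn : ∀ r, (∃ s : Multiset (Fin 3), Multiset.card s = 6 ∧ (s.map d).sum = r) →
      (∃ q s : ℕ, q + s ≤ 6 ∧ q * x + s * y = r) := by
    rintro r ⟨s, hsc, hs⟩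
    obtain ⟨q, t, hqt, hsum⟩ := sum_eq_stamps_zero d x y hxy s
    exact ⟨q, t, by omega, by omega⟩
  have hdeg2 : 37 ≤ (Matrix.det (∑ l, ((Polynomial.X : ℝ[X]) ^ d l) • (S l).map Polynomial.C)).natDegree := hdeg
  exact chain63 x y _ hdeg2 (hIn _ htop) (fun r hr => (hsieve r hr).imp (hIn r) (hIn (r + 1)))

/-! ## m = 7: a step-`≤ 2` chain in `{q·x + s·y : q + s ≤ 7}` stops by `46` -/

set_option maxHeartbeats 4000000 in
/-- Core case `1 ≤ x ≤ 2`, `1 ≤ y`: explicit double gaps (generated leaf by leaf). [folklore] -/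
theorem chain73_core (x y n : ℕ) (hx1 : 1 ≤ x) (hx : x ≤ 2) (hy1 : 1 ≤ y) (hn : 47 ≤ n)
    (hmem : (∃ q s : ℕ, q + s ≤ 7 ∧ q * x + s * y = n))
    (hchain : (∀ r, r + 2 ≤ n → (∃ q s : ℕ, q + s ≤ 7 ∧ q * x + s * y = r) ∨ (∃ q s : ℕ, q + s ≤ 7 ∧ q * x + s * y = (r + 1)))) : False := by
  obtain ⟨q0, s0, hqs0, hn0⟩ := hmem
  interval_cases x
  · -- x = 1: the chain at r = 8 forces y ≤ 9
    have hy : y ≤ 9 := by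
      have h := ybound (m := 7) (n := n) (hG := by omega) (hgap := fun q hq => ⟨by omega, by omega⟩) (hc := hchain 8 (by omega))
      omega
    interval_cases y
    · omega -- y = 1: every sum ≤ 7 < 47
    · omega -- y = 2: every sum ≤ 14 < 47
    · omega -- y = 3: every sum ≤ 21 < 47
    · omega -- y = 4: every sum ≤ 28 < 47
    · omega -- y = 5: every sum ≤ 35 < 47
    · omega -- y = 6: every sum ≤ 42 < 47
    · -- y = 7: sums ≥ 47 start [49]; double gap at 26, 27
      rcases hchain 26 (by omega) with ⟨q, s, hqs, h⟩ | ⟨q, s, hqs, h⟩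
      · have hs' : s ≤ 7 := by omega
        interval_cases s <;> omega
      · have hs' : s ≤ 7 := by omega
        interval_cases s <;> omega
    · -- y = 8: sums ≥ 47 start [48, 49, 56]; double gap at 22, 23
      rcases hchain 22 (by omega) with ⟨q, s, hqs, h⟩ | ⟨q, s, hqs, h⟩
      · have hs' : s ≤ 7 := by omega
        interval_cases s <;> omega
      · have hs' : s ≤ 7 := by omega
        interval_cases s <;> omega
    · -- y = 9: sums ≥ 47 start [47, 54, 55]; double gap at 16, 17
      rcases hchain 16 (by omega) with ⟨q, s, hqs, h⟩ | ⟨q, s, hqs, h⟩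
      · have hs' : s ≤ 7 := by omega
        interval_cases s <;> omega
      · have hs' : s ≤ 7 := by omega
        interval_cases s <;> omega
  · -- x = 2: the chain at r = 15 forces y ≤ 16
    have hy : y ≤ 16 := by
      have h := ybound (m := 7) (n := n) (hG := by omega) (hgap := fun q hq => ⟨by omega, by omega⟩) (hc := hchain 15 (by omega))
      omega
    interval_cases y
    · omega -- y = 1: every sum ≤ 14 < 47
    · omega -- y = 2: every sum ≤ 14 < 47
    · omega -- y = 3: every sum ≤ 21 < 47
    · omega -- y = 4: every sum ≤ 28 < 47
    · omega -- y = 5: every sum ≤ 35 < 47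
    · omega -- y = 6: every sum ≤ 42 < 47
    · -- y = 7: sums ≥ 47 start [49]; double gap at 40, 41
      rcases hchain 40 (by omega) with ⟨q, s, hqs, h⟩ | ⟨q, s, hqs, h⟩
      · have hs' : s ≤ 7 := by omega
        interval_cases s <;> omega
      · have hs' : s ≤ 7 := by omega
        interval_cases s <;> omega
    · -- y = 8: sums ≥ 47 start [48, 50, 56]; double gap at 45, 46
      rcases hchain 45 (by omega) with ⟨q, s, hqs, h⟩ | ⟨q, s, hqs, h⟩
      · have hs' : s ≤ 7 := by omega
        interval_cases s <;> omega
      · have hs' : s ≤ 7 := by omega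
        interval_cases s <;> omega
    · -- y = 9: sums ≥ 47 start [47, 49, 54]; double gap at 43, 44
      rcases hchain 43 (by omega) with ⟨q, s, hqs, h⟩ | ⟨q, s, hqs, h⟩
      · have hs' : s ≤ 7 := by omega
        interval_cases s <;> omega
      · have hs' : s ≤ 7 := by omega
        interval_cases s <;> omega
    · -- y = 10: sums ≥ 47 start [50, 52, 54]; double gap at 47, 48
      rcases hchain 47 (by omega) with ⟨q, s, hqs, h⟩ | ⟨q, s, hqs, h⟩
      · have hs' : s ≤ 7 := by omega
        interval_cases s <;> omega
      · have hs' : s ≤ 7 := by omega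
        interval_cases s <;> omega
    · -- y = 11: sums ≥ 47 start [48, 50, 55]; double gap at 42, 43
      rcases hchain 42 (by omega) with ⟨q, s, hqs, h⟩ | ⟨q, s, hqs, h⟩
      · have hs' : s ≤ 7 := by omega
        interval_cases s <;> omega
      · have hs' : s ≤ 7 := by omega
        interval_cases s <;> omega
    · -- y = 12: sums ≥ 47 start [48, 50, 52]; double gap at 45, 46
      rcases hchain 45 (by omega) with ⟨q, s, hqs, h⟩ | ⟨q, s, hqs, h⟩
      · have hs' : s ≤ 7 := by omega
        interval_cases s <;> omega
      · have hs' : s ≤ 7 := by omega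
        interval_cases s <;> omega
    · -- y = 13: sums ≥ 47 start [47, 52, 54]; double gap at 37, 38
      rcases hchain 37 (by omega) with ⟨q, s, hqs, h⟩ | ⟨q, s, hqs, h⟩
      · have hs' : s ≤ 7 := by omega
        interval_cases s <;> omega
      · have hs' : s ≤ 7 := by omega
        interval_cases s <;> omega
    · -- y = 14: sums ≥ 47 start [48, 50, 56]; double gap at 39, 40
      rcases hchain 39 (by omega) with ⟨q, s, hqs, h⟩ | ⟨q, s, hqs, h⟩
      · have hs' : s ≤ 7 := by omega
        interval_cases s <;> omega
      · have hs' : s ≤ 7 := by omega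
        interval_cases s <;> omega
    · -- y = 15: sums ≥ 47 start [47, 49, 51]; double gap at 28, 29
      rcases hchain 28 (by omega) with ⟨q, s, hqs, h⟩ | ⟨q, s, hqs, h⟩
      · have hs' : s ≤ 7 := by omega
        interval_cases s <;> omega
      · have hs' : s ≤ 7 := by omega
        interval_cases s <;> omega
    · -- y = 16: sums ≥ 47 start [48, 50, 52]; double gap at 29, 30
      rcases hchain 29 (by omega) with ⟨q, s, hqs, h⟩ | ⟨q, s, hqs, h⟩
      · have hs' : s ≤ 7 := by omega
        interval_cases s <;> omega
      · have hs' : s ≤ 7 := by omega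
        interval_cases s <;> omega

/-- **The `(7,3)` sieve bound.** [folklore] -/
theorem chain73 (x y n : ℕ) (hn : 47 ≤ n) (hmem : (∃ q s : ℕ, q + s ≤ 7 ∧ q * x + s * y = n))
    (hchain : (∀ r, r + 2 ≤ n → (∃ q s : ℕ, q + s ≤ 7 ∧ q * x + s * y = r) ∨ (∃ q s : ℕ, q + s ≤ 7 ∧ q * x + s * y = (r + 1)))) : False := by
  have one_denom : ∀ a b : ℕ, a = 0 → (∃ q s : ℕ, q + s ≤ 7 ∧ q * a + s * b = n) → (∀ r, r + 2 ≤ n → (∃ q s : ℕ, q + s ≤ 7 ∧ q * a + s * b = r) ∨ (∃ q s : ℕ, q + s ≤ 7 ∧ q * a + s * b = (r + 1))) → False := by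
    intro a b ha hm hch
    subst ha
    obtain ⟨q1, s1, hqs1, hn1⟩ := hm
    have hb : b ≤ 2 := by
      rcases hch 1 (by omega) with ⟨q, s, hqs, h⟩ | ⟨q, s, hqs, h⟩
      · rcases Nat.eq_zero_or_pos s with hs | hs
        · subst hs; omega
        · have := self_le_mul_of_one_le (b := b) hs; omega
      · rcases Nat.eq_zero_or_pos s with hs | hs
        · subst hs; omega
        · have := self_le_mul_of_one_le (b := b) hs; omega
    interval_cases b <;> omega
  rcases Nat.eq_zero_or_pos x with hx0 | hx1
  · exact one_denom x y hx0 hmem hchain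
  rcases Nat.eq_zero_or_pos y with hy0 | hy1
  · exact one_denom y x hy0 (inS_comm' hmem) (fun r hr => (hchain r hr).imp inS_comm' inS_comm')
  rcases Nat.lt_or_ge x 3 with hx3 | hx3
  · exact chain73_core x y n hx1 (by omega) hy1 hn hmem hchain
  rcases Nat.lt_or_ge y 3 with hy3 | hy3
  · exact chain73_core y x n hy1 (by omega) hx1 hn (inS_comm' hmem) (fun r hr => (hchain r hr).imp inS_comm' inS_comm')
  have key : ∀ r, (∃ q s : ℕ, q + s ≤ 7 ∧ q * x + s * y = r) → r = 0 ∨ 3 ≤ r := by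
    rintro r ⟨q, s, hqs, h⟩
    rcases Nat.eq_zero_or_pos q with hq | hq
    · rcases Nat.eq_zero_or_pos s with hs | hs
      · subst hq; subst hs; left; omega
      · have := self_le_mul_of_one_le (b := y) hs; right; omega
    · have := self_le_mul_of_one_le (b := x) hq; right; omega
  rcases hchain 1 (by omega) with h | h
  · rcases key 1 h with h' | h' <;> omega
  · rcases key 2 h with h' | h' <;> omega

/-- **`η(7,3) ≤ 46 = σ(7,3)`** (`HypRootLawAt 7 3 46`): every real symmetric `7 × 7` lacunary pencil with `3` terms whose
determinant lies in the sector has determinant degree `≤ 46` — ALL supports `d : Fin 3 → ℕ`.  (Realisation of the matching lower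
side, `ν(7,3) = 23`, is OPEN — kit-class search.) [folklore] -/
theorem hypRootLawAt_seven_three_46 : HypRootLawAt 7 3 46 := by
  intro d S hS hsec
  by_contra hdeg'
  have hdeg : 46 < (pencil d S).det.natDegree := not_le.mp hdeg'
  have hq : (pencil d S).det ≠ 0 := by
    intro h0
    rw [h0] at hdeg
    simp at hdeg
  have himage : ∀ r, r ∈ (Finset.univ : Finset (Sym (Fin 3) 7)).image
      (fun s : Sym (Fin 3) 7 => ((s : Multiset (Fin 3)).map d).sum) →
      ∃ s : Multiset (Fin 3), Multiset.card s = 7 ∧ (s.map d).sum = r := by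
    intro r hr
    rw [Finset.mem_image] at hr
    obtain ⟨s, -, hs⟩ := hr
    exact ⟨(s : Multiset (Fin 3)), s.2, hs⟩
  have hsieve : ∀ r, r + 2 ≤ (pencil d S).det.natDegree →
      (∃ s : Multiset (Fin 3), Multiset.card s = 7 ∧ (s.map d).sum = r) ∨
      (∃ s : Multiset (Fin 3), Multiset.card s = 7 ∧ (s.map d).sum = r + 1) := by
    intro r hr
    rcases sieve d S hq hsec hr with h | h
    · exact Or.inl (himage r h)
    · exact Or.inr (himage (r + 1) h)
  have htop := himage _ (natDegree_mem_sumset d S hq)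
  obtain ⟨a, ha⟩ : ∃ a, d a = 0 := by
    rcases hsieve 0 (by omega) with ⟨s, hsc, hs⟩ | ⟨s, hsc, hs⟩
    · exact exists_eq_zero_of_sum_le_one d s (by omega) (by omega)
    · exact exists_eq_zero_of_sum_le_one d s (by omega) (by omega)
  obtain ⟨x, y, hxy⟩ := values_fin_three_zero d a ha
  have hIn : ∀ r, (∃ s : Multiset (Fin 3), Multiset.card s = 7 ∧ (s.map d).sum = r) →
      (∃ q s : ℕ, q + s ≤ 7 ∧ q * x + s * y = r) := by
    rintro r ⟨s, hsc, hs⟩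
    obtain ⟨q, t, hqt, hsum⟩ := sum_eq_stamps_zero d x y hxy s
    exact ⟨q, t, by omega, by omega⟩
  have hdeg2 : 47 ≤ (Matrix.det (∑ l, ((Polynomial.X : ℝ[X]) ^ d l) • (S l).map Polynomial.C)).natDegree := hdeg
  exact chain73 x y _ hdeg2 (hIn _ htop) (fun r hr => (hsieve r hr).imp (hIn r) (hIn (r + 1)))

end Summit.ValiantsHypothesis.ValiantsHypothesis.Theorems.LacunarySymmetroidMatrixDescartes.FiniteSector
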